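import Summits.QuantumFields.BalabanUV.Beta.D1BFx.GhostStencilReflection

/-!
# `BalabanUV.Beta.D1BFx.GhostStencilReflectionQ` — road «BF-x» for binder row D1, sub-leaf A4-leg-PARITY-gh (part 3): KERNEL WITNESS
# THAT T6 v1's CORNER-ROOTED `Q′(U)`-JET `qAnti` IS NOT TRANSPORTED BY THE BLOCK-COMPATIBLE POINT INVERSION (the `cQ ≠ 0` half of the
# parity socket `hSr`), with the structural reason: an axis-`κ′` bond enters the corner-rooted contour only ON THE SPINE through the corner

HONEST DEPENDENCY (page 1, mandatory): continuum YM on T⁴ ⇐ BetaPertH ∧ nine spine estimates (0/9 proved); BetaPertH ⇐ (D1) ∧ (D4) ∧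
CAP+tail; G-an2-4 gates asym, D1 and NE2/3/4.  HONEST FRAMING (cell contract, verbatim): «discharging `BetaPertH` makes Bałaban's UV
stability UNCONDITIONAL — a real constructive-QFT result; it is NOT the continuum limit and NOT the Clay problem.»  THIS FILE DISCHARGES
NOTHING of D1 / BetaPertH: [folklore] finite bookkeeping about the road's OWN typed objects (an1's `AveragingContours.axial`, T6's
`GhostStencil.gammaCoeff/qJet/qAnti`, parts 1–2's `invLeg`/`cInv`); no definition, no `def … : Prop`, no citation, no printed statement
as hypothesis; 0 binders of the hR root are touched.
ABSOLUTE RULE (cell charter, verbatim): «No internally-minted statement may enter as a cited fact. Every hypothesis is either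
kernel-proved in this package or a verbatim quotation of a PUBLISHED theorem with page reference. The manuscript(s) under audit are NOT
citable for their own disputed steps — they are the thing under adjudication; programme-internal (2001/route/tribunal) claims are never
citable.»

WHY.  Part 2 (`GhostStencilReflection`) showed the current's law under `invLeg n` with the bond map `u ↦ cInv n κ′ − u` and the no-go for
T6 v1's head contact.  T6 v1's first-order stencil is `Sgh n cK cQ κ′ u = cK·ghCur κ′ u + cQ·qAnti n κ′ u`; this part settles the `qAnti`
summand: as typed (axial contours rooted at the block's BASE CORNER `n•y`, `GhostStencil` §3) it violates the law for EVERY sign.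
* §1 [folklore] POSITION-AWARE LETTER LEMMA for an1's axial contour: every letter of `Γ_{y,x}` is `±A κ w` at a site `w` whose coordinates
  BELOW `κ` are still the root's (`mem_axialAux_root`; an1's order: axis `3` first, axis `0` last).  Hence **`gammaCoeff_eq_zero_of_lower_ne`**:
  the bond `⟨u, u+e_κ′⟩` has signed multiplicity `0` in `Γ_{y,x}` as soon as `u_j ≠ y_j` for some `j < κ′` — an axis-`κ′` bond is met only on
  the spine through the root.
* §2 [folklore] **`qAnti_cInv_eq_zero`** (`2 ≤ n`, axis `3`): the image bond of `⟨0, e₃⟩` under the point inversion sits at `cInv n 3`, whose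
  `0`-th coordinate `n − 1` is never a corner coordinate `n·y₀` ⟹ `qAnti n 3 (cInv n 3) = 0` identically; whereas **`qAnti_zero_entry`**:
  `qAnti n 3 0 0 e₃ = (n⁴)⁻¹ ≠ 0` (the one-bond contour `Γ_{0,e₃}`).
* §3 [folklore] **NO-GO `qAnti_no_pointInversion_law`** (`2 ≤ n`): for every `σ : ℝ`, `¬ ∀ u, qAnti n 3 (cInv n 3 − u) = σ • refK (invLeg n) (qAnti n 3 u)`;
  corollary `Sgh_no_pointInversion_law_of_cK_zero` (pure averaging-jet stencil, `cQ ≠ 0`).  Together with part 2: neither second ingredient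
  of T6 v1 (`ghCnt`, `qAnti`) is compatible with the inversion parity that the current `ghCur` obeys.
REPAIR DIRECTION (prose; the typer's / owner's call, nothing asserted): root the contour at the block CENTRE `n•y + ctr 4 n`, `n` odd — β-lead
RULING (R32-1) / an5 X-an5-17, objects `AveragingContoursRooted` (an1), reflection law `RootedComb.axProjAt_R1` (an5), used for the spine in
`AxialDressingRootedReflection`; T6's `qJet` is the `ρ = 0` member of such a family.  For EVEN `n` no root lattice is inversion-symmetric
(`2ρ ≡ (n−1)·𝟙 (mod n)` has no solution).  NOT HERE: the rooted family, the mixed case `cK·cQ ≠ 0` (more entries, same method), Ward rows.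
Unit `b2b-balaban-beta-d1-formalise-leaf-01` (gen 3).
-/

noncomputable section

namespace Summit.QuantumFields.BalabanUV.Beta.D1BFx.GhostStencilReflectionQ

open Finset
open scoped BigOperators
open Literature.MathematicalPhysics.QuantumFieldTheory.Balaban1983to89
open Literature.MathematicalPhysics.QuantumFieldTheory.Balaban1983to89.Beta
open B6QGQLower276 (blk side)
open ExpKernelCalculus (Site MKer)
open AffineAveraging (Form1 unitVec unitVec_apply)
open AveragingContours (seg segUp segDown corner axialAux axial axial_self)
open KernelReflection (LegMap refK refK_apply)
open Summit.QuantumFields.BalabanUV.Beta.D1BFx.GhostLeg (side_pred blk_pred_apply)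
open Summit.QuantumFields.BalabanUV.Beta.D1BFx.GhostStencil (bondForm gammaCoeff qJet qAnti qAnti_apply Sgh Sgh_apply ghCur
  unitVec_ne_zero)
open Summit.QuantumFields.BalabanUV.Beta.D1BFx.GhostLegReflection (invLeg)
open Summit.QuantumFields.BalabanUV.Beta.D1BFx.GhostStencilReflection (ctrVec cInv refK_invLeg_apply refK_smul)

/-! ## §1 Position-aware letters of the axial contour -/

/-- [folklore] Letters of a forward segment in direction `κ` from `z`: `A κ w` with `w` on the line `z + ℕe_κ`, so `w` agrees with `z`
off the coordinate `κ`. -/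
theorem mem_segUp_pos {A : Form1 4 ℝ} {z : Site 4} {κ : Fin 4} {m : ℕ} {a : ℝ} (h : a ∈ segUp A z κ m) :
    ∃ w : Site 4, a = A κ w ∧ ∀ j : Fin 4, j ≠ κ → w j = z j := by
  unfold segUp at h
  obtain ⟨s, _, hs⟩ := List.mem_map.mp h
  refine ⟨_, hs.symm, fun j hj => ?_⟩
  simp [unitVec_apply, hj]

/-- [folklore] Letters of a backward segment: `−A κ w` with `w` on the line `z − ℕe_κ`. -/
theorem mem_segDown_pos {A : Form1 4 ℝ} {z : Site 4} {κ : Fin 4} {m : ℕ} {a : ℝ} (h : a ∈ segDown A z κ m) :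
    ∃ w : Site 4, a = -A κ w ∧ ∀ j : Fin 4, j ≠ κ → w j = z j := by
  unfold segDown at h
  obtain ⟨s, _, hs⟩ := List.mem_map.mp h
  refine ⟨_, hs.symm, fun j hj => ?_⟩
  simp [unitVec_apply, hj]

/-- [folklore] Letters of a signed segment in direction `κ` from `z`: `±A κ w` with `w` agreeing with `z` off the coordinate `κ`. -/
theorem mem_seg_pos {A : Form1 4 ℝ} {z : Site 4} {κ : Fin 4} {m : ℤ} {a : ℝ} (h : a ∈ seg A z κ m) :
    ∃ w : Site 4, (a = A κ w ∨ a = -A κ w) ∧ ∀ j : Fin 4, j ≠ κ → w j = z j := by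
  unfold seg at h
  split_ifs at h
  · obtain ⟨w, hw, hwj⟩ := mem_segUp_pos h
    exact ⟨w, Or.inl hw, hwj⟩
  · obtain ⟨w, hw, hwj⟩ := mem_segDown_pos h
    exact ⟨w, Or.inr hw, hwj⟩

/-- [folklore] **POSITION-AWARE LETTER LEMMA.**  Every letter of the partial axial contour `axialAux A y x m` (the segments of directions
`m−1, …, 0`) is `±A κ w` with `κ < m` and a site `w` whose coordinates `j < κ` are still the ROOT's: `w j = y j`. -/
theorem mem_axialAux_root {A : Form1 4 ℝ} {y x : Site 4} {a : ℝ} :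
    ∀ m, a ∈ axialAux A y x m → ∃ (κ : Fin 4) (w : Site 4), (a = A κ w ∨ a = -A κ w) ∧ ∀ j : Fin 4, (j : ℕ) < κ → w j = y j
  | 0, h => by simp [axialAux] at h
  | m + 1, h => by
      simp only [axialAux, List.mem_append] at h
      rcases h with h | h
      · split_ifs at h with hm
        · obtain ⟨w, hw, hwj⟩ := mem_seg_pos h
          refine ⟨⟨m, hm⟩, w, hw, fun j hj => ?_⟩
          have hj' : (j : ℕ) < m := hj
          have hne : j ≠ ⟨m, hm⟩ := fun hh => by rw [hh] at hj'; exact lt_irrefl _ hj'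
          rw [hwj j hne]
          show (if m + 1 ≤ (j : ℕ) then x j else y j) = y j
          rw [if_neg (by omega)]
        · simp at h
      · exact mem_axialAux_root m h

/-- [folklore] The same for the full contour `axial = axialAux · · · 4`. -/
theorem mem_axial_root {A : Form1 4 ℝ} {y x : Site 4} {a : ℝ} (h : a ∈ axial A y x) :
    ∃ (κ : Fin 4) (w : Site 4), (a = A κ w ∨ a = -A κ w) ∧ ∀ j : Fin 4, (j : ℕ) < κ → w j = y j :=
  mem_axialAux_root 4 h

/-- [folklore] **AN AXIS-`κ′` BOND IS MET ONLY ON THE SPINE THROUGH THE ROOT**: if `u_j ≠ y_j` for some coordinate `j < κ′`, the bond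
`⟨u, u + e_κ′⟩` has signed multiplicity `0` in the corner-rooted contour `Γ_{y,x}`, for EVERY endpoint `x`. -/
theorem gammaCoeff_eq_zero_of_lower_ne (κ' : Fin 4) {u y : Site 4} (j : Fin 4) (hj : (j : ℕ) < κ') (hne : u j ≠ y j) (x : Site 4) :
    gammaCoeff κ' u y x = 0 := by
  unfold gammaCoeff
  refine List.sum_eq_zero fun a ha => ?_
  obtain ⟨κ, w, hw, hwj⟩ := mem_axial_root ha
  have h0 : bondForm κ' u κ w = 0 := by
    unfold bondForm
    rw [if_neg]
    rintro ⟨hκ, hwu⟩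
    subst hκ
    exact hne (by rw [← hwu]; exact (hwj j hj))
  rcases hw with hw | hw
  · rw [hw, h0]
  · rw [hw, h0, neg_zero]

/-! ## §2 The image of the spine bond `⟨0, e₃⟩` carries the zero jet; the bond itself does not -/

variable (n : ℕ) [NeZero n]

omit [NeZero n] in
/-- [folklore] The `0`-th coordinate of `cInv n 3` is `n − 1`. -/
theorem cInv_three_apply_zero : cInv n 3 (0 : Fin 4) = (n : ℤ) - 1 := by
  show ((n : ℤ) - 1) - unitVec (3 : Fin 4) (0 : Fin 4) = (n : ℤ) - 1
  rw [unitVec_apply, if_neg (by decide), sub_zero]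

omit [NeZero n] in
/-- [folklore] For `2 ≤ n`, `n − 1` is not a multiple of `n`: the image bond's base is never on a corner spine. -/
theorem pred_ne_mul (hn : 2 ≤ n) (k : ℤ) : (n : ℤ) - 1 ≠ (n : ℤ) * k := by
  intro h
  have h1 : ((n : ℤ) - 1) % (n : ℤ) = (n : ℤ) - 1 := Int.emod_eq_of_lt (by omega) (by omega)
  have h2 : ((n : ℤ) * k) % (n : ℤ) = 0 := Int.mul_emod_right _ _
  rw [h] at h1
  rw [h2] at h1
  omega

omit [NeZero n] in
/-- [folklore] **THE JET OF THE IMAGE BOND VANISHES**: `qJet n 3 (cInv n 3) y x = 0` for all `y`, `x` (`2 ≤ n`). -/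
theorem qJet_cInv_eq_zero (hn : 2 ≤ n) (y x : Site 4) : qJet n 3 (cInv n 3) y x = 0 := by
  unfold qJet
  split_ifs with h
  · rw [gammaCoeff_eq_zero_of_lower_ne 3 (j := 0) (by decide) ?_ x, mul_zero]
    rw [cInv_three_apply_zero, Pi.smul_apply, smul_eq_mul]
    exact pred_ne_mul n hn (y 0)
  · rfl

omit [NeZero n] in
/-- [folklore] **`qAnti n 3 (cInv n 3) = 0`** (`2 ≤ n`): T6 v1's averaging jet of the image of `⟨0, e₃⟩` under the point inversion is the
ZERO kernel. -/
theorem qAnti_cInv_eq_zero (hn : 2 ≤ n) : qAnti n 3 (cInv n 3) = 0 := by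
  funext x z a b
  rw [qAnti_apply, qJet_cInv_eq_zero n hn, qJet_cInv_eq_zero n hn, sub_zero]
  rfl

/-- [folklore] The one-bond contour `Γ_{0, e₃}` consists of the single letter `A 3 0`. -/
theorem axial_zero_unitVec_three (A : Form1 4 ℝ) : axial A 0 (unitVec (3 : Fin 4)) = [A 3 0] := by
  have hfin : (⟨3, by norm_num⟩ : Fin 4) = 3 := rfl
  show axialAux A 0 (unitVec 3) 4 = [A 3 0]
  simp [axialAux, seg, segUp, unitVec_apply, hfin]

/-- [folklore] `gammaCoeff 3 0 0 e₃ = 1`: the bond `⟨0, e₃⟩` is `Γ_{0,e₃}` itself. -/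
theorem gammaCoeff_three_zero_unitVec : gammaCoeff 3 0 0 (unitVec (3 : Fin 4)) = 1 := by
  unfold gammaCoeff
  rw [axial_zero_unitVec_three, List.sum_singleton]
  unfold bondForm
  rw [if_pos ⟨rfl, rfl⟩]

/-- [folklore] `gammaCoeff κ′ u y y = 0` (the empty contour). -/
theorem gammaCoeff_self (κ' : Fin 4) (u y : Site 4) : gammaCoeff κ' u y y = 0 := by
  unfold gammaCoeff
  rw [axial_self, List.sum_nil]

/-- [folklore] Block labels in road units: `blk (n−1) 0 = 0`. -/
theorem blk_zero : blk (n - 1) (0 : Site 4) = 0 := by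
  funext μ; rw [blk_pred_apply, Pi.zero_apply, Int.zero_ediv]

/-- [folklore] Block labels in road units: `blk (n−1) e₃ = 0` for `2 ≤ n`. -/
theorem blk_unitVec (hn : 2 ≤ n) : blk (n - 1) (unitVec (3 : Fin 4)) = 0 := by
  funext μ
  rw [blk_pred_apply, unitVec_apply, Pi.zero_apply]
  split_ifs
  · exact Int.ediv_eq_zero_of_lt (by norm_num) (by omega)
  · exact Int.zero_ediv _

/-- [folklore] **THE ENTRY THAT DOES NOT VANISH**: `qAnti n 3 0 0 e₃ = (n⁴)⁻¹` (`2 ≤ n`). -/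
theorem qAnti_zero_entry (hn : 2 ≤ n) (a b : Unit) : qAnti n 3 0 0 (unitVec (3 : Fin 4)) a b = ((n : ℝ) ^ 4)⁻¹ := by
  rw [qAnti_apply, blk_zero, blk_unitVec n hn]
  unfold qJet
  rw [blk_zero, blk_unitVec n hn, if_pos ⟨rfl, rfl⟩, if_pos ⟨rfl, rfl⟩, smul_zero, gammaCoeff_three_zero_unitVec, gammaCoeff_self,
    mul_one, mul_zero, sub_zero]

/-- [folklore] Hence `qAnti n 3 0 ≠ 0` (`2 ≤ n`). -/
theorem qAnti_zero_ne_zero (hn : 2 ≤ n) : qAnti n 3 0 ≠ 0 := by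
  intro h
  have hx := congr_fun (congr_fun (congr_fun (congr_fun h 0) (unitVec (3 : Fin 4))) ()) ()
  rw [qAnti_zero_entry n hn] at hx
  have hn' : (0 : ℝ) < ((n : ℝ) ^ 4)⁻¹ := by
    have : (0 : ℝ) < n := by exact_mod_cast (show 0 < n by omega)
    positivity
  exact hn'.ne' hx

/-! ## §3 The no-go for the averaging jet -/

/-- [folklore] **NO-GO FOR T6 v1's `Q′(U)`-JET**: for `2 ≤ n` and EVERY sign `σ`, the law
`∀ u, qAnti n 3 (cInv n 3 − u) = σ • refK (invLeg n) (qAnti n 3 u)` (the `hSr` shape with the current's bond map) is FALSE.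
Proof: at `u = 0` the left side is the zero kernel while the right side has the entry `σ·(n⁴)⁻¹`, so `σ = 0`; then at `u = cInv n 3` the
law says `qAnti n 3 0 = 0`, contradicting `qAnti_zero_entry`. -/
theorem qAnti_no_pointInversion_law (hn : 2 ≤ n) (σ : ℝ)
    (h : ∀ u : Site 4, qAnti n 3 (cInv n 3 - u) = σ • refK (invLeg n) (qAnti n 3 u)) : False := by
  have h0 := h 0
  rw [sub_zero, qAnti_cInv_eq_zero n hn] at h0
  have hx := congr_fun (congr_fun (congr_fun (congr_fun h0 (ctrVec n)) (ctrVec n - unitVec (3 : Fin 4))) ()) ()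
  rw [Pi.zero_apply, Pi.zero_apply, Pi.zero_apply, Pi.zero_apply, Pi.smul_apply, Pi.smul_apply, Pi.smul_apply, Pi.smul_apply,
    smul_eq_mul, refK_invLeg_apply, sub_self, sub_sub_cancel, qAnti_zero_entry n hn] at hx
  have hn' : ((n : ℝ) ^ 4)⁻¹ ≠ 0 := by
    have : (0 : ℝ) < n := by exact_mod_cast (show 0 < n by omega)
    positivity
  have hσ : σ = 0 := by
    rcases mul_eq_zero.1 hx.symm with h | h
    · exact h
    · exact absurd h hn'
  have h1 := h (cInv n 3)
  rw [sub_self, hσ, zero_smul] at h1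
  exact qAnti_zero_ne_zero n hn h1

/-- [folklore] **COROLLARY FOR THE PURE AVERAGING-JET STENCIL** `Sgh n 0 cQ` (`cQ ≠ 0`, `2 ≤ n`): the `hSr` socket of
`FineHessianReflection.bondSecondMoment_Pgh_eq_avgM2_of_refl` has no instantiation with the point inversion and the current's bond map,
whatever the sign. -/
theorem Sgh_no_pointInversion_law_of_cK_zero (hn : 2 ≤ n) {cQ : ℝ} (hQ : cQ ≠ 0) (σ : ℝ)
    (h : ∀ u : Site 4, Sgh n 0 cQ 3 (cInv n 3 - u) = σ • refK (invLeg n) (Sgh n 0 cQ 3 u)) : False := by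
  have hS : ∀ v, Sgh n 0 cQ 3 v = cQ • qAnti n 3 v := fun v => by
    funext x z a b
    rw [Sgh_apply, Pi.smul_apply, Pi.smul_apply, Pi.smul_apply, Pi.smul_apply, smul_eq_mul, zero_mul, zero_add]
  refine qAnti_no_pointInversion_law n hn σ fun u => ?_
  have hu := h u
  rw [hS, hS, refK_smul, smul_comm] at hu
  exact smul_right_injective _ hQ hu

end Summit.QuantumFields.BalabanUV.Beta.D1BFx.GhostStencilReflectionQ

end
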